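import Mathlib.Topology.UnitInterval
import Mathlib.Analysis.Complex.Basic
import Mathlib.Topology.Path
import HarnessLib

/-!
# Reparametrising pieces of paths (generic helpers for the continuum crossing arguments)

Topic `Probability/Percolation`; two small generic lemmas used by the proofs files towards
Schramm–Smirnov's Lemma 6.1 (`QuadCrossingSeparatorArm.lean`, `QuadCrossingContinuityCaseThreeSmall.lean`),
where crossings and dual paths are handled as maps `ℝ → ℂ` continuous on `[0,1]`:

* `exists_reparam` — the piece `[a, b]` of such a map, affinely reparametrised to `[0,1]`;
* `exists_path_of_continuousOn` — such a map packaged as a Mathlib `Path` between its endpoints.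

No percolation content; [folklore].
-/

noncomputable section

open scoped unitInterval
open Set

namespace Literature.Probability.Percolation

namespace QuadCrossing

/-! ### Reparametrising a piece of a path -/

/-- **Affine reparametrisation of a piece of a path.**  For `γ` continuous on `[0,1]` and
`0 ≤ a ≤ b ≤ 1`, the map `t ↦ γ (a + t (b - a))` is continuous on `[0,1]`, runs from `γ a` to `γ b`,
and takes values `γ s`, `s ∈ [a, b]`. [folklore] -/
theorem exists_reparam {γ : ℝ → ℂ} (hγ : ContinuousOn γ (Icc 0 1)) {a b : ℝ} (ha : 0 ≤ a)
    (hab : a ≤ b) (hb : b ≤ 1) :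
    ContinuousOn (fun t : ℝ => γ (a + t * (b - a))) (Icc 0 1) ∧
      (fun t : ℝ => γ (a + t * (b - a))) 0 = γ a ∧ (fun t : ℝ => γ (a + t * (b - a))) 1 = γ b ∧
      ∀ t ∈ Icc (0 : ℝ) 1, a + t * (b - a) ∈ Icc a b := by
  have hmaps : ∀ t ∈ Icc (0 : ℝ) 1, a + t * (b - a) ∈ Icc a b := fun t ht =>
    ⟨by nlinarith [ht.1], by nlinarith [ht.2]⟩
  refine ⟨hγ.comp (by fun_prop) fun t ht => ?_, by simp, by simp, hmaps⟩
  obtain ⟨h1, h2⟩ := hmaps t ht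
  exact ⟨ha.trans h1, h2.trans hb⟩

/-- A map continuous on `[0,1]`, packaged as a Mathlib `Path` between its
endpoints (restriction to the unit interval). [folklore] -/
theorem exists_path_of_continuousOn {γ : ℝ → ℂ} (hγ : ContinuousOn γ (Icc 0 1)) :
    ∃ p : Path (γ 0) (γ 1), ∀ t : I, p t = γ t := by
  let p : Path (γ 0) (γ 1) :=
    { toFun := fun t : I => γ t
      continuous_toFun := hγ.comp_continuous continuous_subtype_val fun t => t.2
      source' := rfl
      target' := rfl }
  exact ⟨p, fun t => rfl⟩

end QuadCrossing

end Literature.Probability.Percolation
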